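import Summits.AtomisticToContinuum.FouriersLaw.Theses.EmbeddedDrudeMourre
import Summits.AtomisticToContinuum.FouriersLaw.Theorems.BondHeatUncertaintySubdiffusiveBondHeatKernelGibbsE
import Literature.MathematicalPhysics.KineticTheory.LangevinChainNESSProofs

/-!
# `FiniteResponseOfUnique` (stmt-AtomisticToContinuum-0717): the fundamental-matrix representation of a steady expectation

`--supports` helper file for the shared support item `FiniteResponseOfUnique` (route decl
`Summit.AtomisticToContinuum.FouriersLaw.Theses.EmbeddedDrudeMourre.FiniteResponseOfUnique`).
First line of the Hairer–Majda linear-response argument (Hairer–Majda, *A simple framework to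
justify linear response theory*, Nonlinearity 23 (2010), proof of Thm 2.3: `μ_ε - μ_0 =
μ_ε (𝒫_ε - 𝒫_0)(1 - 𝒫_0)⁻¹` on centred observables), for the pinned chain at equilibrium
temperature `T`, with the skeleton `𝒫_0 = P⁰_{t₀}` of the equilibrium transition semigroup:

* §1 `abs_integral_transitionKernel_le_geometric` — CEHR (2.5) at equal temperatures for
  exponentially dominated centred observables: `|P⁰_t g(z)| ≤ K C e^{ϑH(z)} e^{-ct}` when
  `|g| ≤ K e^{ϑH}`, `μ_T(g) = 0` (from `pinnedChain_exp_convergence_gibbs`).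
* §2 `exists_poissonSum` — the discrete Poisson (fundamental-matrix) solution
  `G = Σ_{n ≥ 0} P⁰_{n t₀} g`: strongly measurable, `|G| ≤ C' e^{ϑH}`, and `G = g + P⁰_{t₀} G`
  pointwise (geometric convergence from §1, Chapman–Kolmogorov, `P⁰_0 = id`).
* §3 `integral_eq_integral_act_sub` — for ANY Langevin-chain semigroup `S` of the pinned chain (any
  bath temperatures) and any `S`-invariant probability measure `μ` integrating `G`, `g`, `S_{t₀}G`:
  `∫ g dμ = ∫ (S_{t₀} G - P⁰_{t₀} G) dμ` — the steady expectation of `g` is the expectation of a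
  FINITE-TIME sensitivity of the transition kernels applied to `G`. With `S` the semigroup at
  temperatures `T ± δ/2` and `μ = μ_δ` the unique steady state (identified with the CEHR invariant
  measure in `EmbeddedDrudeMourreFiniteResponseOfUnique.lean` §6) this is the exact identity
  `μ_δ(j_i) = μ_δ((P^δ_{t₀} - P⁰_{t₀}) G_i)`; the item's remaining content is the limit `δ → 0` of
  `(P^δ_{t₀} - P⁰_{t₀}) G_i / δ` (a weighted-`C¹` bound on `G_i`, Hairer–Majda Assumption 1) and
  the weak continuity of `δ ↦ μ_δ`.
-/

noncomputable section

namespace Summit.AtomisticToContinuum.FouriersLaw.Theorems.FiniteResponse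

open MeasureTheory ProbabilityTheory Filter Topology
open scoped NNReal ENNReal
open Literature.MathematicalPhysics.KineticTheory.HeatConduction
open Summit.AtomisticToContinuum.FouriersLaw.Theorems.SubdiffusiveBondHeat

variable {ω₂ lam β γ : ℝ} (hω : 0 < ω₂) (hl : 0 ≤ lam) (hβ : 0 < β) (hγ : 0 < γ) {N : ℕ} (hN : 0 < N)
  {T : ℝ} (hT : 0 < T)

section Equilibrium
include hω hl hβ hγ hN hT

/-! ## §1 Geometric decay of the equilibrium semigroup on centred observables -/

/-- **CEHR (2.5) at equal temperatures, for dominated centred observables**: for `0 < ϑ < 1/T`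
there are `C, c > 0` such that for every continuous `g` with `|g| ≤ K e^{ϑH}` (`K > 0`) and
`∫ g dμ_T = 0`: `|∫ g dP⁰_t(z, ·)| ≤ K C e^{ϑH(z)} e^{-ct}` for all `z`, `t ≥ 0`.
[cite: CuneoEckmannHairerReyBellet2018, Thm 2.13 (3)] -/
theorem abs_integral_transitionKernel_le_geometric {ϑ : ℝ} (hϑ0 : 0 < ϑ) (hϑ1 : ϑ < 1 / T) :
    ∃ C c : ℝ, 0 < C ∧ 0 < c ∧ ∀ (g : PhaseSpace N → ℝ), Continuous g → ∀ (K : ℝ), 0 < K →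
      (∀ y, |g y| ≤ K * Real.exp (ϑ * (pinnedChain ω₂ lam β γ).hamiltonian N y)) →
      ∫ y, g y ∂((pinnedChain ω₂ lam β γ).gibbsMeasure N T) = 0 →
      ∀ (z : PhaseSpace N) (t : ℝ≥0),
        |∫ y, g y ∂((pinnedChain ω₂ lam β γ).transitionKernel N T T t z)| ≤
          K * C * Real.exp (ϑ * (pinnedChain ω₂ lam β γ).hamiltonian N z) * Real.exp (-c * t) := by
  obtain ⟨C, c, hC, hc, h⟩ := pinnedChain_exp_convergence_gibbs hω hl hβ hγ hN hT hϑ0 hϑ1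
  refine ⟨C, c, hC, hc, fun g hg K hK hgK hg0 z t => ?_⟩
  have hf : ∀ y, |K⁻¹ * g y| ≤ Real.exp (ϑ * (pinnedChain ω₂ lam β γ).hamiltonian N y) := by
    intro y
    rw [abs_mul, abs_of_pos (inv_pos.2 hK), inv_mul_le_iff₀ hK]
    exact hgK y
  have hb := h z t (fun y => K⁻¹ * g y) (continuous_const.mul hg) hf
  rw [integral_const_mul, integral_const_mul, hg0, mul_zero, sub_zero, abs_mul,
    abs_of_pos (inv_pos.2 hK), inv_mul_le_iff₀ hK] at hb
  calc |∫ y, g y ∂((pinnedChain ω₂ lam β γ).transitionKernel N T T t z)|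
      ≤ K * (C * Real.exp (ϑ * (pinnedChain ω₂ lam β γ).hamiltonian N z) * Real.exp (-c * t)) := hb
    _ = K * C * Real.exp (ϑ * (pinnedChain ω₂ lam β γ).hamiltonian N z) * Real.exp (-c * t) := by
        ring

/-! ## §2 The discrete Poisson (fundamental-matrix) solution `G = Σₙ P⁰_{n t₀} g` -/

/-- **The fundamental-matrix / discrete Poisson solution at equilibrium.** For `0 < ϑ < 1/T`,
`t₀ > 0` and a continuous observable `g` with `|g| ≤ K e^{ϑH}` and `∫ g dμ_T = 0`, the series
`G(x) = Σ_{n ≥ 0} ∫ g dP⁰_{n t₀}(x, ·)` converges (geometrically, by (2.5)), defines a strongly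
measurable function with `|G| ≤ C' e^{ϑH}`, and solves the discrete Poisson equation
`G = g + P⁰_{t₀} G` pointwise (Chapman–Kolmogorov and `P⁰_0 = id`). [Hairer–Majda 2010, proof
of Thm 2.3 (`(1 - 𝒫_0)⁻¹` on centred observables)] [folklore] -/
theorem exists_poissonSum {ϑ : ℝ} (hϑ0 : 0 < ϑ) (hϑ1 : ϑ < 1 / T) (t₀ : ℝ≥0) (ht₀ : 0 < t₀)
    {g : PhaseSpace N → ℝ} (hg : Continuous g) {K : ℝ} (hK : 0 < K)
    (hgK : ∀ y, |g y| ≤ K * Real.exp (ϑ * (pinnedChain ω₂ lam β γ).hamiltonian N y))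
    (hg0 : ∫ y, g y ∂((pinnedChain ω₂ lam β γ).gibbsMeasure N T) = 0) :
    ∃ G : PhaseSpace N → ℝ, StronglyMeasurable G ∧
      (∃ C' : ℝ, 0 < C' ∧
        ∀ x, |G x| ≤ C' * Real.exp (ϑ * (pinnedChain ω₂ lam β γ).hamiltonian N x)) ∧
      (∀ x, HasSum (fun n : ℕ =>
        ∫ y, g y ∂((pinnedChain ω₂ lam β γ).transitionKernel N T T (n * t₀) x)) (G x)) ∧
      ∀ x, G x = g x + ∫ y, G y ∂((pinnedChain ω₂ lam β γ).transitionKernel N T T t₀ x) := by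
  set P := pinnedChain ω₂ lam β γ with hP
  set Hm : PhaseSpace N → ℝ := P.hamiltonian N with hHm
  set Kk : ℝ≥0 → Kernel (PhaseSpace N) (PhaseSpace N) := P.transitionKernel N T T with hKk
  haveI hMarkov : ∀ t, IsMarkovKernel (Kk t) := fun t =>
    pinnedChain_isMarkovKernel_transitionKernel hω hl hβ.le hγ.le N T T t
  obtain ⟨C, c, hC, hc, hconv⟩ :=
    abs_integral_transitionKernel_le_geometric hω hl hβ hγ hN hT hϑ0 hϑ1
  -- the iterates `a n x = P⁰_{n t₀} g (x)` and their geometric bound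
  set a : ℕ → PhaseSpace N → ℝ := fun n x => ∫ y, g y ∂(Kk (n * t₀) x) with ha
  set r : ℝ := Real.exp (-c * t₀) with hr
  have hr0 : 0 < r := Real.exp_pos _
  have hr1 : r < 1 := by
    rw [hr, Real.exp_lt_one_iff]
    have : (0 : ℝ) < t₀ := ht₀
    nlinarith
  have hab : ∀ n x, |a n x| ≤ K * C * Real.exp (ϑ * Hm x) * r ^ n := by
    intro n x
    have h := hconv g hg K hK hgK hg0 x (n * t₀)
    have hexp : Real.exp (-c * ((n * t₀ : ℝ≥0) : ℝ)) = r ^ n := by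
      rw [hr, ← Real.exp_nat_mul]
      push_cast
      ring_nf
    rwa [hexp] at h
  have ham : ∀ n, StronglyMeasurable (a n) := fun n =>
    hg.stronglyMeasurable.integral_kernel (κ := Kk (n * t₀))
  have hsum : ∀ x, Summable fun n => a n x := fun x =>
    Summable.of_norm_bounded ((summable_geometric_of_lt_one hr0.le hr1).mul_left
      (K * C * Real.exp (ϑ * Hm x))) fun n => by rw [Real.norm_eq_abs]; exact hab n x
  -- the candidate
  refine ⟨fun x => ∑' n, a n x, ?_, ?_, fun x => (hsum x).hasSum, fun x => ?_⟩
  · -- strong measurability: pointwise limit of the partial sums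
    refine stronglyMeasurable_of_tendsto atTop
      (f := fun m x => ∑ n ∈ Finset.range m, a n x) (fun m => ?_) ?_
    · have : (fun x => ∑ n ∈ Finset.range m, a n x) = ∑ n ∈ Finset.range m, a n := by
        funext x; simp [Finset.sum_apply]
      rw [this]
      exact Finset.stronglyMeasurable_sum _ fun n _ => ham n
    · exact tendsto_pi_nhds.2 fun x => (hsum x).hasSum.tendsto_sum_nat
  · -- the weighted bound `|G| ≤ K C (1 - r)⁻¹ e^{ϑH}`
    refine ⟨K * C * (1 - r)⁻¹, by
      have := sub_pos.2 hr1
      positivity, fun x => ?_⟩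
    have hgeo : HasSum (fun n : ℕ => K * C * Real.exp (ϑ * Hm x) * r ^ n)
        (K * C * Real.exp (ϑ * Hm x) * (1 - r)⁻¹) :=
      (hasSum_geometric_of_lt_one hr0.le hr1).mul_left _
    have h := tsum_of_norm_bounded hgeo fun n => by rw [Real.norm_eq_abs]; exact hab n x
    rw [Real.norm_eq_abs] at h
    calc |∑' n, a n x| ≤ K * C * Real.exp (ϑ * Hm x) * (1 - r)⁻¹ := h
      _ = K * C * (1 - r)⁻¹ * Real.exp (ϑ * Hm x) := by ring
  · -- the discrete Poisson equation `G = g + P⁰_{t₀} G`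
    have hmax : ϑ < 1 / max T T := by rwa [max_self]
    -- `e^{ϑH}` is integrable for `P⁰_s(x, ·)`
    have hexpint : ∀ (s : ℝ≥0) (z : PhaseSpace N),
        Integrable (fun y => Real.exp (ϑ * Hm y)) (Kk s z) := fun s z =>
      pinnedChain_integrable_exp_mul_hamiltonian_transitionKernel hω hl hT hβ.le hγ.le hN hϑ0 hϑ1 s z
    -- `g` is integrable for `P⁰_s(x, ·)`
    have hgint : ∀ (s : ℝ≥0) (z : PhaseSpace N), Integrable g (Kk s z) := fun s z =>
      integrable_of_abs_le_exp (hexpint s z) hg hgK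
    -- `a n` is integrable for `P⁰_{t₀}(x, ·)`, with summable `L¹` norms
    have haint : ∀ n, Integrable (a n) (Kk t₀ x) := fun n =>
      ((hexpint t₀ x).const_mul (K * C * r ^ n)).mono' (ham n).aestronglyMeasurable
        (Eventually.of_forall fun y => by
          rw [Real.norm_eq_abs]
          calc |a n y| ≤ K * C * Real.exp (ϑ * Hm y) * r ^ n := hab n y
            _ = K * C * r ^ n * Real.exp (ϑ * Hm y) := by ring)
    have hnorm : Summable fun n => ∫ y, ‖a n y‖ ∂(Kk t₀ x) := by
      refine Summable.of_nonneg_of_le (fun n => integral_nonneg fun y => norm_nonneg _)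
        (fun n => ?_) (((summable_geometric_of_lt_one hr0.le hr1).mul_left
          (K * C * ∫ y, Real.exp (ϑ * Hm y) ∂(Kk t₀ x))))
      calc ∫ y, ‖a n y‖ ∂(Kk t₀ x)
          ≤ ∫ y, K * C * r ^ n * Real.exp (ϑ * Hm y) ∂(Kk t₀ x) := by
            refine integral_mono (haint n).norm ((hexpint t₀ x).const_mul _) fun y => ?_
            rw [Real.norm_eq_abs]
            calc |a n y| ≤ K * C * Real.exp (ϑ * Hm y) * r ^ n := hab n y
              _ = K * C * r ^ n * Real.exp (ϑ * Hm y) := by ring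
        _ = K * C * (∫ y, Real.exp (ϑ * Hm y) ∂(Kk t₀ x)) * r ^ n := by
            rw [integral_const_mul]; ring
    -- `∫ G dP⁰_{t₀}(x, ·) = Σₙ ∫ a n dP⁰_{t₀}(x, ·)`
    have hswap : HasSum (fun n => ∫ y, a n y ∂(Kk t₀ x)) (∫ y, ∑' n, a n y ∂(Kk t₀ x)) :=
      hasSum_integral_of_summable_integral_norm haint hnorm
    -- Chapman–Kolmogorov: `∫ a n dP⁰_{t₀}(x, ·) = a (n+1) x`
    have hCK : ∀ n, ∫ y, a n y ∂(Kk t₀ x) = a (n + 1) x := by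
      intro n
      have hadd : Kk ((n + 1 : ℕ) * t₀) = Kk (n * t₀) ∘ₖ Kk t₀ := by
        have : ((n + 1 : ℕ) : ℝ≥0) * t₀ = t₀ + n * t₀ := by push_cast; ring
        rw [this]
        exact pinnedChain_transitionKernel_add hω hl hβ.le hγ.le N T T t₀ (n * t₀)
      have hint : Integrable g ((Kk (n * t₀) ∘ₖ Kk t₀) x) := by
        rw [← hadd]; exact hgint _ x
      change ∫ y, (∫ w, g w ∂(Kk (n * t₀) y)) ∂(Kk t₀ x) = ∫ w, g w ∂(Kk ((n + 1 : ℕ) * t₀) x)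
      rw [hadd, Kernel.integral_comp hint]
    -- `a 0 = g`
    have ha0 : a 0 x = g x := by
      change ∫ y, g y ∂(Kk ((0 : ℕ) * t₀) x) = g x
      rw [Nat.cast_zero, zero_mul, hKk, pinnedChain_transitionKernel_zero hω hl hβ.le hγ.le N T T,
        Kernel.id_apply, integral_dirac]
    -- assemble
    have h1 : ∫ y, ∑' n, a n y ∂(Kk t₀ x) = ∑' n, a (n + 1) x := by
      rw [← hswap.tsum_eq]
      exact tsum_congr hCK
    have h2 : ∑' n, a n x = a 0 x + ∑' n, a (n + 1) x := (hsum x).tsum_eq_zero_add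
    change ∑' n, a n x = g x + ∫ y, ∑' n, a n y ∂(Kk t₀ x)
    rw [h1, h2, ha0]

end Equilibrium

/-! ## §3 The fundamental-matrix representation of a steady expectation -/

/-- **`∫ g dμ = ∫ (S_{t₀} G - P⁰_{t₀} G) dμ`.** Let `G = g + P⁰_{t₀} G` pointwise (the discrete
Poisson equation of §2, `P⁰` the equilibrium transition kernels at temperature `T`), let `S` be ANY
Langevin-chain semigroup of the pinned chain (any bath temperatures) and `μ` an `S`-invariant
probability measure for which `G`, `g` and `S_{t₀} G` are integrable. Then the steady expectation of
`g` is the `μ`-expectation of the finite-time kernel sensitivity `(S_{t₀} - P⁰_{t₀}) G`: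
`μ(g) = μ(G) - μ(P⁰_{t₀}G) = μ(S_{t₀}G) - μ(P⁰_{t₀}G)` by invariance. [Hairer–Majda 2010,
proof of Thm 2.3] [folklore] -/
theorem integral_eq_integral_act_sub {T_L T_R : ℝ}
    (S : LangevinChainSemigroup (pinnedChain ω₂ lam β γ) N T_L T_R) {μ : Measure (PhaseSpace N)}
    [IsProbabilityMeasure μ] (hinv : S.IsInvariant μ) (t₀ : ℝ≥0) {g G : PhaseSpace N → ℝ}
    (hGg : ∀ x, G x = g x + ∫ y, G y ∂((pinnedChain ω₂ lam β γ).transitionKernel N T T t₀ x))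
    (hG : Integrable G μ) (hg : Integrable g μ) (hSG : Integrable (S.act t₀ G) μ) :
    ∫ x, g x ∂μ =
      ∫ x, (S.act t₀ G x - ∫ y, G y ∂((pinnedChain ω₂ lam β γ).transitionKernel N T T t₀ x)) ∂μ := by
  have hP0 : ∀ x, ∫ y, G y ∂((pinnedChain ω₂ lam β γ).transitionKernel N T T t₀ x) = G x - g x := by
    intro x
    have := hGg x
    linarith
  have hP0int : Integrable
      (fun x => ∫ y, G y ∂((pinnedChain ω₂ lam β γ).transitionKernel N T T t₀ x)) μ :=
    (hG.sub hg).congr (Eventually.of_forall fun x => (hP0 x).symm)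
  have h1 : ∫ x, (S.act t₀ G x - ∫ y, G y ∂((pinnedChain ω₂ lam β γ).transitionKernel N T T t₀ x)) ∂μ
      = (∫ x, S.act t₀ G x ∂μ) - ∫ x, (G x - g x) ∂μ := by
    rw [integral_sub hSG hP0int]
    exact congrArg _ (integral_congr_ae (Eventually.of_forall hP0))
  rw [h1, hinv.integral_act S t₀ hG, integral_sub hG hg]
  ring

/-! ## §4 The representation for the bond currents of the pinned chain -/

section Currents
include hω hl hβ hγ hN hT

omit hγ hT in
/-- An exponential domination of the bond currents: `|j_i| ≤ K e^{ϑH}` with an explicit `K > 0`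
(`|j_i| ≤ N(3+β)/2 (1+H)²` and `(1+H)² ≤ 2e^ϑ ϑ⁻² e^{ϑH}`). [folklore] -/
theorem abs_bondCurrent_le_exp {ϑ : ℝ} (hϑ0 : 0 < ϑ) (i : Fin N) :
    ∃ K : ℝ, 0 < K ∧ ∀ y, |(pinnedChain ω₂ lam β γ).bondCurrent N i y| ≤
      K * Real.exp (ϑ * (pinnedChain ω₂ lam β γ).hamiltonian N y) := by
  refine ⟨N * ((3 + β) / 2) * (2 * Real.exp ϑ / ϑ ^ 2), ?_, fun y => ?_⟩
  · have : (0 : ℝ) < N := by exact_mod_cast hN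
    positivity
  have hH0 := pinnedChain_hamiltonian_nonneg hω.le hl hβ.le γ N y
  calc |(pinnedChain ω₂ lam β γ).bondCurrent N i y|
      ≤ N * ((3 + β) / 2 * (1 + (pinnedChain ω₂ lam β γ).hamiltonian N y) ^ 2) :=
        pinnedChain_abs_bondCurrent_le hω.le hl hβ.le γ N i y
    _ = N * ((3 + β) / 2) * (1 + (pinnedChain ω₂ lam β γ).hamiltonian N y) ^ 2 := by ring
    _ ≤ N * ((3 + β) / 2) * (2 * Real.exp ϑ / ϑ ^ 2 *
          Real.exp (ϑ * (pinnedChain ω₂ lam β γ).hamiltonian N y)) :=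
        mul_le_mul_of_nonneg_left (one_add_sq_le_exp hH0 hϑ0) (by positivity)
    _ = _ := by ring

omit hT in
/-- Weighted domination is propagated by the transition kernels at ANY bath temperatures
(CEHR (3.4)): if `|G| ≤ C' e^{ϑH}` with `G` strongly measurable and `0 < ϑ < 1/max(T_L,T_R)`,
then `x ↦ ∫ G dP^{T_L,T_R}_t(x, ·)` is dominated by `C' e^{ϑγ(T_L+T_R)t} e^{ϑH(x)}` and is
integrable for every measure integrating `e^{ϑH}`. [folklore] -/
theorem integrable_act_of_abs_le_exp {T_L T_R : ℝ} (hL : 0 < T_L) (hR : 0 < T_R) {ϑ : ℝ}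
    (hϑ0 : 0 < ϑ) (hϑ2 : ϑ < 1 / max T_L T_R) {G : PhaseSpace N → ℝ} (hGm : StronglyMeasurable G)
    {C' : ℝ} (hC' : 0 ≤ C')
    (hGb : ∀ x, |G x| ≤ C' * Real.exp (ϑ * (pinnedChain ω₂ lam β γ).hamiltonian N x))
    (t : ℝ≥0) {μ : Measure (PhaseSpace N)}
    (hint : Integrable (fun z => Real.exp (ϑ * (pinnedChain ω₂ lam β γ).hamiltonian N z)) μ) :
    (∀ x, |∫ y, G y ∂((pinnedChain ω₂ lam β γ).transitionKernel N T_L T_R t x)| ≤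
      C' * Real.exp (ϑ * γ * (T_L + T_R) * t) *
        Real.exp (ϑ * (pinnedChain ω₂ lam β γ).hamiltonian N x)) ∧
    Integrable (fun x => ∫ y, G y ∂((pinnedChain ω₂ lam β γ).transitionKernel N T_L T_R t x)) μ := by
  set P := pinnedChain ω₂ lam β γ with hP
  set Hm : PhaseSpace N → ℝ := P.hamiltonian N with hHm
  haveI : ∀ s, IsMarkovKernel (P.transitionKernel N T_L T_R s) := fun s =>
    pinnedChain_isMarkovKernel_transitionKernel hω hl hβ.le hγ.le N T_L T_R s
  have hcont : Continuous fun y : PhaseSpace N => Real.exp (ϑ * Hm y) :=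
    Real.continuous_exp.comp (continuous_const.mul (pinnedChain_continuous_hamiltonian ω₂ lam β γ N))
  -- (3.4) in real form
  have h34 : ∀ x, ∫ y, Real.exp (ϑ * Hm y) ∂(P.transitionKernel N T_L T_R t x) ≤
      Real.exp (ϑ * γ * (T_L + T_R) * t) * Real.exp (ϑ * Hm x) := by
    intro x
    have hb := lintegral_exp_mul_hamiltonian_pinnedChainSemigroup_le hω hl hβ.le hγ.le hN hL.le hR.le
      hL hR hϑ0 hϑ2 t x
    rw [integral_eq_lintegral_of_nonneg_ae (Eventually.of_forall fun y => (Real.exp_pos _).le)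
      hcont.aestronglyMeasurable]
    exact ENNReal.toReal_le_of_le_ofReal (by positivity) hb
  have hexpint : ∀ x, Integrable (fun y => Real.exp (ϑ * Hm y)) (P.transitionKernel N T_L T_R t x) := by
    intro x
    have hb := lintegral_exp_mul_hamiltonian_pinnedChainSemigroup_le hω hl hβ.le hγ.le hN hL.le hR.le
      hL hR hϑ0 hϑ2 t x
    refine ⟨hcont.aestronglyMeasurable, ?_⟩
    rw [hasFiniteIntegral_iff_ofReal (Eventually.of_forall fun y => (Real.exp_pos _).le)]
    exact lt_of_le_of_lt hb ENNReal.ofReal_lt_top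
  have hdom : ∀ x, |∫ y, G y ∂(P.transitionKernel N T_L T_R t x)| ≤
      C' * Real.exp (ϑ * γ * (T_L + T_R) * t) * Real.exp (ϑ * Hm x) := by
    intro x
    have h1 : |∫ y, G y ∂(P.transitionKernel N T_L T_R t x)| ≤
        ∫ y, C' * Real.exp (ϑ * Hm y) ∂(P.transitionKernel N T_L T_R t x) := by
      rw [← Real.norm_eq_abs]
      refine norm_integral_le_of_norm_le ((hexpint x).const_mul C')
        (Eventually.of_forall fun y => ?_)
      rw [Real.norm_eq_abs]; exact hGb y
    rw [integral_const_mul] at h1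
    calc _ ≤ C' * ∫ y, Real.exp (ϑ * Hm y) ∂(P.transitionKernel N T_L T_R t x) := h1
      _ ≤ C' * (Real.exp (ϑ * γ * (T_L + T_R) * t) * Real.exp (ϑ * Hm x)) :=
          mul_le_mul_of_nonneg_left (h34 x) hC'
      _ = _ := by ring
  refine ⟨hdom, ?_⟩
  refine ((hint.const_mul (C' * Real.exp (ϑ * γ * (T_L + T_R) * t))).mono'
    (hGm.integral_kernel (κ := P.transitionKernel N T_L T_R t)).aestronglyMeasurable
    (Eventually.of_forall fun x => ?_))
  rw [Real.norm_eq_abs]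
  exact hdom x

/-- **The fundamental-matrix representation of the steady bond currents.** Let `T > 0` (the
equilibrium temperature), `T_L, T_R > 0` (the bath temperatures), `μ` an invariant probability
measure of the transition semigroup at `(T_L, T_R)` integrating `e^{ϑH}` for some
`0 < ϑ < min(1/T, 1/max(T_L,T_R))`, `t₀ > 0` and `i` a bond. Then with the Poisson sum
`G_i = Σₙ P⁰_{n t₀} j_i` of the bond current at equilibrium temperature `T` (§2; `μ_T(j_i) = 0`):
`∫ j_i dμ = ∫ (P^{T_L,T_R}_{t₀} G_i - P⁰_{t₀} G_i) dμ`. For the unique steady state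
`μ = μ_{N,T+δ/2,T-δ/2}` this is `μ_δ(j_i) = μ_δ((P^δ_{t₀} - P⁰_{t₀}) G_i)`: the first line of the
Hairer–Majda argument for item 0717. [Hairer–Majda 2010, proof of Thm 2.3] [folklore] -/
theorem integral_bondCurrent_eq_integral_sensitivity {T_L T_R : ℝ} (hL : 0 < T_L) (hR : 0 < T_R)
    {μ : Measure (PhaseSpace N)} [IsProbabilityMeasure μ]
    (hinv : (pinnedChainSemigroup hω hl hβ.le hγ.le hN hL.le hR.le).IsInvariant μ)
    {ϑ : ℝ} (hϑ0 : 0 < ϑ) (hϑ1 : ϑ < 1 / T) (hϑ2 : ϑ < 1 / max T_L T_R)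
    (hint : Integrable (fun z => Real.exp (ϑ * (pinnedChain ω₂ lam β γ).hamiltonian N z)) μ)
    (t₀ : ℝ≥0) (ht₀ : 0 < t₀) (i : Fin N) :
    ∃ G : PhaseSpace N → ℝ, StronglyMeasurable G ∧
      (∃ C' : ℝ, 0 < C' ∧
        ∀ x, |G x| ≤ C' * Real.exp (ϑ * (pinnedChain ω₂ lam β γ).hamiltonian N x)) ∧
      (∀ x, HasSum (fun n : ℕ => ∫ y, (pinnedChain ω₂ lam β γ).bondCurrent N i y
        ∂((pinnedChain ω₂ lam β γ).transitionKernel N T T (n * t₀) x)) (G x)) ∧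
      (∀ x, G x = (pinnedChain ω₂ lam β γ).bondCurrent N i x +
        ∫ y, G y ∂((pinnedChain ω₂ lam β γ).transitionKernel N T T t₀ x)) ∧
      ∫ x, (pinnedChain ω₂ lam β γ).bondCurrent N i x ∂μ =
        ∫ x, ((∫ y, G y ∂((pinnedChain ω₂ lam β γ).transitionKernel N T_L T_R t₀ x)) -
          ∫ y, G y ∂((pinnedChain ω₂ lam β γ).transitionKernel N T T t₀ x)) ∂μ := by
  obtain ⟨K, hK, hjK⟩ := abs_bondCurrent_le_exp hω hl hβ hN hϑ0 i
  obtain ⟨G, hGm, ⟨C', hC', hGb⟩, hsum, hGeq⟩ := exists_poissonSum hω hl hβ hγ hN hT hϑ0 hϑ1 t₀ ht₀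
    (pinnedChain_continuous_bondCurrent ω₂ lam β γ N i) hK hjK
    (pinnedChain_integral_bondCurrent_gibbsMeasure ω₂ lam β γ N T i)
  refine ⟨G, hGm, ⟨C', hC', hGb⟩, hsum, hGeq, ?_⟩
  have hG : Integrable G μ :=
    (hint.const_mul C').mono' hGm.aestronglyMeasurable (Eventually.of_forall fun x => by
      rw [Real.norm_eq_abs]; exact hGb x)
  have hj : Integrable ((pinnedChain ω₂ lam β γ).bondCurrent N i) μ :=
    pinnedChain_integrable_bondCurrent_of_integrable_exp hω.le hl hβ.le γ N hϑ0 hint i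
  have hSG := (integrable_act_of_abs_le_exp hω hl hβ hγ hN hL hR hϑ0 hϑ2 hGm hC'.le hGb t₀ hint).2
  exact integral_eq_integral_act_sub (pinnedChainSemigroup hω hl hβ.le hγ.le hN hL.le hR.le) hinv t₀
    hGeq hG hj hSG

end Currents

end Summit.AtomisticToContinuum.FouriersLaw.Theorems.FiniteResponse

end
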